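import Summits.ResolutionOfSingularities.ResolutionOfSingularities.Theorems.EquisingularLiftEquisingularLiftNatTowerCurveStepThree
import Summits.ResolutionOfSingularities.ResolutionOfSingularities.Theorems.EquisingularLiftEquisingularLiftNatTowerInvBDefs
import Summits.ResolutionOfSingularities.ResolutionOfSingularities.Theorems.EquisingularLiftEquisingularLiftNatStrictTransformFlat
import Summits.ResolutionOfSingularities.ResolutionOfSingularities.Theorems.EquisingularLiftEquisingularLiftCentreBlowupFlatExceptional
import Summits.ResolutionOfSingularities.ResolutionOfSingularities.Theorems.EquisingularLiftEquisingularLiftNatSubchainSupplierInvSDefs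
import HarnessLib

/-!
# [OURS · L1 W4.5(b) · EL♮(3) · T23-A″-S] HSUB′(ReachTowerB″-S) — THE CURVE STEP OF THE B″-S TOWER DRIVER WITH THE SEEDED PLANE:
# `TCPlus.InvS ⇒ Tower.InvB … F₁₀ (𝟙 F₁₀) (St T₉) (υ'⁻¹Z₉) [St S₉] (St K₉)` — twin of res-L1-w45b-stub-4's `Tower.inv₃_of_invKCL_curveStep`
# (…NatTowerCurveStepThree; lineage res-D-pv-029 `Tower.inv₂_of_invKC_curveStep`) with the plane's strict transform as a RETAINED MEMBER
# (crux `EquisingularLiftNatThree` = stmt-ResolutionOfSingularities-20148, parent stmt-…-20038; T23-A″-S, stub-4 memo 16d03a46d50c8ccd §S / SHAPE WORD 08:22:44Z)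

res-type-027 g18, brick (S-8) of the object «A″-S UPSTAIRS TWINS» (res-L1-w45b-plan-1 desk RULING R20 (iv) / DESK WORD 2026-08-28T08:15:46Z). OURS; NOT a
statement of any manuscript ([Hironaka2017] is a candidate under adjudication, nothing of it is asserted); AI-written, weaker than expert review. No
`sorry`; standard axioms. DEF-FREE. `--supports stmt-ResolutionOfSingularities-20148 --as helper`; closes nothing by itself.

WHAT. `Tower.invB_of_invS_curveStep`: res-L1-w45b-stub-4's `Tower.inv₃_of_invKCL_curveStep` VERBATIM for the running surface and the cone shadow
(credit: res-D-pv-029 g8 / res-L1-w45b-stub-4 g8; consumes `TCPlus.InvS` through its `MemberS` conjuncts (i)–(viii)), CONCLUDING IN THE MEMBER SHAPE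
the B″ assembly consumes (engine owner's SHAPE WORD): `Tower.InvB … Ruled … F₁₀ (𝟙 F₁₀) (closure υ'⁻¹(T₉ ∖ Z₉)) (υ'⁻¹Z₉) [closure υ'⁻¹(S₉ ∖ Z₉)]
(closure υ'⁻¹(K₉ ∖ Z₉))` — the seed of `ReachTowerBDoublePrimeS` with the plane's strict transform `St S₉` RETAINED, its datum
`Tower.Exc₃ … (St S₉) hF ∅ X₁₀ (τ ≫ σ) j₁₀` in the SAME upstairs stage realised by `𝓕 := strictTransformIdeal τ (𝓢 ⊔ K) 𝓢`:
(e-i) `𝓕·𝒪_{F₁₀} = 𝓘⟨St S₉⟩` by res-D-pv-051's `coneRound_exceptional_comap 𝓢 K` (…NatConeRoundTransport p549332; the curve step IS a cone round with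
`𝓔 := 𝓢`) over the plane trace (ix), its Cartier hypothesis `IsEffectiveCartier (K.comap 𝓢.subschemeι)` = clause (viii) SWAPPED
(res-L1-w45b-stub-4 `isEffectiveCartier_comap_subschemeι_swap`: `𝓢`, `K` locally principal, `V(𝓢)` regular, `K ≠ ⊥`); (e-ii)
`isPrincipal_stalkIdeal_strictTransformIdeal`; (e-iii) `V(𝓕) ≅ V(𝓢)` (`exists_iso_subscheme_strictTransformIdeal_exceptional`) regular by (iii); (e-iv)
`supp 𝓕 ⊆ τ⁻¹ supp 𝓢` and `σ '' supp 𝓢` off the generic point of `Y` by `image_support_subset_not_isGenericPoint_of_chain` (…NatCentreOffGeneric) from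
`T₉ ⊄ closure S₉`; (e-v) a SECOND stand-in `hRuledS` (the member's ruled-surface datum; at `Ruled := FE` it is res-L1-w45b-stub-2's T-STFLAT-GEN over
clause (x) — discharged in `Tower.invB_of_invS_curveStep_FE`, where `hRuled` is discharged by `flat_exceptional_of_isBlowup_regularCentre` as in V10′);
shadow forgotten (`Or.inl rfl`); downstairs bookkeeping `IsClosed (St S₉) ∧ ¬ St T₉ ⊆ St S₉` from `T₉` irreducible, `T₉ ⊄ S₉`, `T₉ ⊄ Z₉`.
EXTRA HYPOTHESES w.r.t. the KCL brick: `hYsp : Y ⊆ q⁻¹{𝔪_O}` (as in the `_sec` corollaries) and the plane's downstairs side facts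
`IsClosed S₉`, `S₉ ⊆ closure (S₉ ∖ Z₉)`, `¬ T₉ ⊆ S₉` (pure topology along the inner chain; seed `υ⁻¹{x}`).

References: U. Görtz, T. Wedhorn, *Algebraic Geometry I* (2020), (13.19), Prop. 13.91 [GortzWedhorn2020]; Q. Liu, *Algebraic Geometry and Arithmetic
Curves* (2002), Thm. 8.1.19 [Liu2002]; R. Hartshorne, *Algebraic Geometry* (1977), III Prop. 9.7 [Hartshorne1977] — through the cited tree files.
-/

set_option linter.dupNamespace false -- mandated namespace `Summit.<Summit>.<Problem>` of this single-conjunct summit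
set_option linter.overlappingInstances false -- signatures carry `[IsDomain O] [IsDiscreteValuationRing O]`

noncomputable section

open CategoryTheory CategoryTheory.Limits AlgebraicGeometry TopologicalSpace Topology IsLocalRing
open Literature.AlgebraicGeometry.Resolution
open AlgebraicGeometry.Scheme.IdealSheafData
open Summit.ResolutionOfSingularities.ResolutionOfSingularities.Theses.EquisingularLift.Split
open Summit.ResolutionOfSingularities.ResolutionOfSingularities.Cruxes.EquisingularLift.StrataSplit

namespace Summit.ResolutionOfSingularities.ResolutionOfSingularities.Cruxes.EquisingularLiftNat.Sections

set_option maxHeartbeats 800000 in -- one large refine over a 20-clause invariant (as the KCL brick)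
/-- **THE CURVE STEP OF THE B″-S TOWER DRIVER, `TCPlus.InvS ⇒ Tower.InvB` WITH THE SEEDED PLANE `[St S₉]`** (see the module docstring), modulo the
two ruled-surface stand-ins `hRuled` (running surface) and `hRuledS` (seeded member). [cite: GortzWedhorn2020, (13.19) and Prop. 13.91]
[cite: Liu2002, Thm. 8.1.19] [OURS · L1 W4.5b · T23-A″-S] clause (curve) of the B″-S driver at `INV := InvS`, `INV₁B := InvB`, brick (S-8)
(stmt-ResolutionOfSingularities-20148 / -20038); NOT a statement of the manuscript. -/
theorem Tower.invB_of_invS_curveStep (O : Type) [CommRing O] [IsDomain O] [IsDiscreteValuationRing O] (k : Type) [Field k]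
    (θ : O →+* k) (hθ : Function.Surjective θ)
    (P : Scheme.{0}) (q : P ⟶ Spec (.of O)) [IsProper q] (Y : Set P) (hYsp : Y ⊆ q ⁻¹' {closedPoint O})
    (hYirr : IsIrreducible Y) (hYcl : IsClosed Y)
    (hPnoeth : IsLocallyNoetherian P) (hPreg : Scheme.IsRegular P)
    (Ch : ∀ X' : Scheme.{0}, (X' ⟶ P) → Set X' → Prop)
    (hChain : ∀ (X' : Scheme.{0}) (σ : X' ⟶ P) (S : Set X'), Ch X' σ S → Chain P Y X' σ S)
    (hStep : ∀ (X' X'' : Scheme.{0}) (σ' : X' ⟶ P) (S' : Set X') (C : X'.IdealSheafData) (τ : X'' ⟶ X'),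
      Ch X' σ' S' → IsBlowup τ C → Scheme.IsRegular C.subscheme → Flat (C.subschemeι ≫ σ' ≫ q) →
      σ' '' (C.support : Set X') ⊆ {x : P | ¬ IsGenericPoint x Y} →
      (C.support : Set X') ∩ (σ' ≫ q) ⁻¹' {IsLocalRing.closedPoint O} ⊆ S' →
      Ch X'' (τ ≫ σ') (closure (τ ⁻¹' (S' \ (C.support : Set X')))))
    (Ruled : Tower.RuledDatum P)
    {F₁ F₂ : Scheme.{0}} (W : Set F₁) (F₉ : Scheme.{0}) (β₉ : F₉ ⟶ F₂) (T₉ Z₉ K₉ S₉ : Set F₉) (b₉ : Bool) (hZ₉ : IsClosed Z₉)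
    (F₁₀ : Scheme.{0}) (υ' : F₁₀ ⟶ F₉)
    (hI : TCPlus.InvS O k θ P q Y Ch W F₉ β₉ T₉ Z₉ K₉ S₉ b₉) (hZinf : Z₉.Infinite) (hKcl : IsClosed K₉) (hKne : K₉ ≠ Set.univ)
    (hKdense : K₉ ⊆ closure (K₉ \ Z₉))
    -- downstairs side facts of the plane: closed, `Z₉` nowhere dense in it, not containing the running curve
    (hScl : IsClosed S₉) (hSdense : S₉ ⊆ closure (S₉ \ Z₉)) (hTS₉ : ¬ T₉ ⊆ S₉)
    (hZT : Z₉ ⊆ T₉) (hTZ : ¬ T₉ ⊆ Z₉) (hυ' : IsBlowup υ' (vanishingIdeal ⟨Z₉, hZ₉⟩))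
    -- STAND-IN (owner res-L1-w45b-stub-2 / res-type-027): the ruled-surface datum of the new exceptional surface, root = this step
    (hRuled : ∀ (X : Scheme.{0}) (σ : X ⟶ P) (S : Set X) (jG : F₉ ⟶ X) (tG : F₉ ⟶ Spec (.of k)) (𝓢 K : X.IdealSheafData)
        (X₁₀ : Scheme.{0}) (τ : X₁₀ ⟶ X) (j₁₀ : F₁₀ ⟶ X₁₀) (t₁₀ : F₁₀ ⟶ Spec (.of k)),
        Ch X σ S → IsIntegral X → IsLocallyNoetherian X → Scheme.IsRegular X → IsDominant (σ ≫ q) →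
        IsPullback jG tG (σ ≫ q) (Spec.map (CommRingCat.ofHom θ)) → jG '' T₉ = S →
        (𝓢 ⊔ K).comap jG = vanishingIdeal ⟨Z₉, hZ₉⟩ → Flat ((𝓢 ⊔ K).subschemeι ≫ σ ≫ q) → Scheme.IsRegular (𝓢 ⊔ K).subscheme →
        Scheme.IsRegular 𝓢.subscheme → IsBlowup τ (𝓢 ⊔ K) → IsPullback j₁₀ t₁₀ ((τ ≫ σ) ≫ q) (Spec.map (CommRingCat.ofHom θ)) →
        j₁₀ ≫ τ = υ' ≫ jG →
        Ruled F₉ Z₉ hZ₉ F₁₀ υ' F₁₀ (𝟙 F₁₀) (υ' ⁻¹' Z₉) X₁₀ (τ ≫ σ) j₁₀ ((𝓢 ⊔ K).comap τ))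
    -- STAND-IN (S): the ruled-surface datum of the SEEDED MEMBER `St S₉`, model `St_{𝓢 ⊔ K} 𝓢` (at `FE`: T-STFLAT-GEN, see `…_FE` below)
    (hRuledS : ∀ (X : Scheme.{0}) (σ : X ⟶ P) (S : Set X) (jG : F₉ ⟶ X) (tG : F₉ ⟶ Spec (.of k)) (𝓢 K : X.IdealSheafData)
        (X₁₀ : Scheme.{0}) (τ : X₁₀ ⟶ X) (j₁₀ : F₁₀ ⟶ X₁₀) (t₁₀ : F₁₀ ⟶ Spec (.of k)),
        Ch X σ S → IsIntegral X → IsLocallyNoetherian X → Scheme.IsRegular X → IsDominant (σ ≫ q) →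
        IsPullback jG tG (σ ≫ q) (Spec.map (CommRingCat.ofHom θ)) → jG '' T₉ = S →
        (𝓢 ⊔ K).comap jG = vanishingIdeal ⟨Z₉, hZ₉⟩ → Flat ((𝓢 ⊔ K).subschemeι ≫ σ ≫ q) → Scheme.IsRegular (𝓢 ⊔ K).subscheme →
        Scheme.IsRegular 𝓢.subscheme → IsBlowup τ (𝓢 ⊔ K) → IsPullback j₁₀ t₁₀ ((τ ≫ σ) ≫ q) (Spec.map (CommRingCat.ofHom θ)) →
        j₁₀ ≫ τ = υ' ≫ jG →
        𝓢.comap jG = vanishingIdeal ⟨closure S₉, isClosed_closure⟩ → Flat (𝓢.subschemeι ≫ σ ≫ q) →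
        Ruled F₉ Z₉ hZ₉ F₁₀ υ' F₁₀ (𝟙 F₁₀) (closure (υ' ⁻¹' (S₉ \ Z₉))) X₁₀ (τ ≫ σ) j₁₀ (strictTransformIdeal τ (𝓢 ⊔ K) 𝓢)) :
    Tower.InvB O k θ P q Y Ch Ruled F₉ Z₉ hZ₉ F₁₀ υ' F₁₀ (𝟙 F₁₀) (closure (υ' ⁻¹' (T₉ \ Z₉))) (υ' ⁻¹' Z₉)
      [closure (υ' ⁻¹' (S₉ \ Z₉))] (closure (υ' ⁻¹' (K₉ \ Z₉))) := by
  classical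
  obtain ⟨hGint, hT₉cl, hT₉irr, -, hmem, -⟩ := hI
  obtain ⟨X, σ, S, jG, tG, 𝓢, K, hCh, hXint, hXnoeth, hXreg, hdom, hsq, hTS, hi, hii, hiii, hiiip, hiv, hv, -, ⟨V, hZV, hvii⟩, hviii, hix,
    hSflat⟩ := hmem
  haveI := hGint
  haveI := hXint
  haveI := hXnoeth
  -- the closed carrier curve
  have hZcl : (⟨closure Z₉, isClosed_closure⟩ : Closeds F₉) = ⟨Z₉, hZ₉⟩ := Closeds.ext hZ₉.closure_eq
  have hCD : (𝓢 ⊔ K).comap jG = vanishingIdeal ⟨Z₉, hZ₉⟩ := by rw [← hZcl]; exact hi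
  have hKD : (K.comap jG).comap V.ι = (vanishingIdeal (⟨closure K₉, isClosed_closure⟩ : Closeds F₉)).comap V.ι := hvii
  -- properness of the stage
  obtain ⟨-, -, hσ⟩ := chain_isRegular P Y X σ S (hChain _ _ _ hCh) hPnoeth hPreg
  haveI := hσ
  haveI : IsProper (σ ≫ q) := inferInstance
  -- the model square: `jG` is a closed immersion onto the special fibre
  haveI : IsClosedImmersion (Spec.map (CommRingCat.ofHom θ)) := IsClosedImmersion.spec_of_surjective _ hθ
  haveI hjci : IsClosedImmersion jG := MorphismProperty.IsStableUnderBaseChange.of_isPullback hsq.flip inferInstance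
  have hjsp : ∀ z : F₉, (σ ≫ q) (jG z) = closedPoint O := fun z => by
    have h1 : jG z ∈ Set.range jG := ⟨z, rfl⟩
    rw [range_eq_preimage_of_isPullback hsq, range_specMap_of_surjective_of_field θ hθ] at h1
    exact h1
  -- the centre `𝒞 = 𝓢 ⊔ K` is regular: regular quotient stalks over the closed point + properness
  have hCreg_pt : ∀ x ∈ ((𝓢 ⊔ K).support : Set X), (σ ≫ q) x = closedPoint O →
      IsRegularLocalRing (X.presheaf.stalk x ⧸ stalkIdeal (𝓢 ⊔ K) x) := fun x hx hqx => (hv x hx hqx (by simp)).1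
  haveI : IsProper ((𝓢 ⊔ K).subschemeι ≫ σ ≫ q) := inferInstance
  have hCreg : Scheme.IsRegular (𝓢 ⊔ K).subscheme :=
    Scheme.isRegular_subscheme_of_forall_over_closedPoint (σ ≫ q) (𝓢 ⊔ K) fun x hx hqx => hCreg_pt x hx hqx
  -- support bookkeeping downstairs
  have hsuppZ : ((vanishingIdeal ⟨Z₉, hZ₉⟩ : F₉.IdealSheafData).support : Set F₉) = Z₉ := Scheme.IdealSheafData.coe_support_vanishingIdeal _
  have hDT : ((vanishingIdeal ⟨Z₉, hZ₉⟩ : F₉.IdealSheafData).support : Set F₉) ⊆ T₉ := by rw [hsuppZ]; exact hZT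
  have hTD : ¬ T₉ ⊆ ((vanishingIdeal ⟨Z₉, hZ₉⟩ : F₉.IdealSheafData).support : Set F₉) := by rw [hsuppZ]; exact hTZ
  -- blow up the centre and run the model step
  obtain ⟨X₂, τ, hτ⟩ := exists_isBlowup X (𝓢 ⊔ K)
  obtain ⟨hint₂, hnoeth₂, hreg₂, hdom₂, hF₂, hirr, j₂, t₂, hsq₂, hcomm, hCh₂⟩ :=
    modelStep_chain O k θ hθ P q Y hYirr hYcl Ch hChain hStep X σ S hCh hXreg hdom F₉ jG tG hsq T₉ hTS (𝓢 ⊔ K)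
      (vanishingIdeal ⟨Z₉, hZ₉⟩) hCD hCreg hii hiv hDT hTD X₂ τ hτ F₁₀ υ' hυ'
  rw [hsuppZ] at hirr hCh₂
  haveI := hint₂
  haveI := hnoeth₂
  haveI := hF₂
  haveI : IsProper τ := hτ.isProper
  -- the cartesian model square of the step
  have hcart : IsPullback j₂ υ' τ jG := isPullback_of_model_squares θ hθ (σ ≫ q) τ jG tG hsq j₂ t₂
    (by simpa only [Category.assoc] using hsq₂) υ' hcomm
  -- a point of `F₁₀` off the exceptional surface, and `T₁₀ ⊄ E₁₀`
  obtain ⟨t, htT, htZ⟩ := Set.not_subset.mp hTZ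
  obtain ⟨t', ht'⟩ := hυ'.exists_preimage_of_not_mem_support (z := t) (by rw [hsuppZ]; exact htZ)
  have hTE : ¬ closure (υ' ⁻¹' (T₉ \ Z₉)) ⊆ υ' ⁻¹' Z₉ := by
    intro h
    have h1 : t' ∈ closure (υ' ⁻¹' (T₉ \ Z₉)) :=
      subset_closure (show υ' t' ∈ T₉ \ Z₉ by rw [ht']; exact ⟨htT, htZ⟩)
    have h2 : υ' t' ∈ Z₉ := h h1
    rw [ht'] at h2
    exact htZ h2
  have hCne : 𝓢 ⊔ K ≠ ⊥ := by
    rintro hbot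
    obtain ⟨u, hu, hKu⟩ := hτ.isEffectiveCartier.exists_stalkIdeal_eq_span (j₂ t')
    rw [hbot, Scheme.IdealSheafData.comap_bot, stalkIdeal_bot, eq_comm, Ideal.span_singleton_eq_bot] at hKu
    rw [hKu] at hu
    exact zero_notMem_nonZeroDivisors hu
  -- quasi-regular frames of the centre at the special points of `Z₉`
  have hqr : ∀ z ∈ ((⟨Z₉, hZ₉⟩ : Closeds F₉) : Set F₉), ∃ (n : ℕ) (c : Fin n → X.presheaf.stalk (jG z)),
      Ideal.span (Set.range c) = stalkIdeal (𝓢 ⊔ K) (jG z) ∧ IsQuasiRegular c := by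
    intro z hz
    have hzC : jG z ∈ ((𝓢 ⊔ K).support : Set X) := by
      have h1 : z ∈ (((𝓢 ⊔ K).comap jG).support : Set F₉) := by rw [hCD, hsuppZ]; exact hz
      rw [Scheme.IdealSheafData.support_comap] at h1
      exact h1
    haveI : IsRegularLocalRing (X.presheaf.stalk (jG z)) := hXreg (jG z)
    haveI : IsRegularLocalRing (X.presheaf.stalk (jG z) ⧸ stalkIdeal (𝓢 ⊔ K) (jG z)) := hCreg_pt _ hzC (hjsp z)
    obtain ⟨n, c, -, hc, hq, -⟩ := exists_isQuasiRegular_span_eq_of_isRegularLocalRing_quotient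
      (J := stalkIdeal (𝓢 ⊔ K) (jG z)) ((mem_support_iff_stalkIdeal_le _ _).mp hzC) (stalkIdeal (𝓢 ⊔ K) (jG z) : Set _)
      (Ideal.span_eq _)
    exact ⟨n, c, hc, hq⟩
  -- (e-i) exact reduced trace of the new exceptional surface
  have he1 : ((𝓢 ⊔ K).comap τ).comap j₂ = vanishingIdeal ⟨υ' ⁻¹' Z₉, hZ₉.preimage υ'.continuous⟩ :=
    comap_comap_eq_vanishingIdeal_preimage_of_model O k θ hθ (σ ≫ q) jG tG hsq (𝓢 ⊔ K) τ hτ j₂ t₂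
      (by simpa only [Category.assoc] using hsq₂) υ' hcomm ⟨Z₉, hZ₉⟩ hCD hqr
  -- (e-ii) locally principal
  have he2 : ∀ z : X₂, (stalkIdeal ((𝓢 ⊔ K).comap τ) z).IsPrincipal := fun z => by
    obtain ⟨u, -, hu⟩ := hτ.isEffectiveCartier.exists_stalkIdeal_eq_span z
    exact ⟨⟨u, by rw [hu, Ideal.submodule_span_eq]⟩⟩
  -- (e-iii) regular
  have he3 : Scheme.IsRegular ((𝓢 ⊔ K).comap τ).subscheme := hτ.isRegular_subscheme_comap hXreg hCreg
  -- (e-iv) off the generic point of `Y`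
  have he4 : (τ ≫ σ) '' (((𝓢 ⊔ K).comap τ).support : Set X₂) ⊆ {p : P | ¬ IsGenericPoint p Y} := by
    rintro _ ⟨z, hz, rfl⟩
    rw [Scheme.IdealSheafData.support_comap] at hz
    exact hiv ⟨τ z, hz, rfl⟩
  -- the shadow: the curve step is a cone round with `𝓔 := 𝓢` (clause (viii) is its Cartier hypothesis)
  have hk1 : ∀ z : X₂, (stalkIdeal (strictTransformIdeal τ (𝓢 ⊔ K) K) z).IsPrincipal := fun z =>
    isPrincipal_stalkIdeal_strictTransformIdeal hXreg hCreg hτ hCne K (fun z => (hiiip z).2) z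
  have hKc : K₉ = closure K₉ := hKcl.closure_eq.symm
  have hk2 : ((strictTransformIdeal τ (𝓢 ⊔ K) K).comap j₂).comap (υ' ⁻¹ᵁ V).ι =
      (vanishingIdeal (⟨closure (closure (υ' ⁻¹' (K₉ \ Z₉))), isClosed_closure⟩ : Closeds F₁₀)).comap (υ' ⁻¹ᵁ V).ι := by
    have h := coneRound_shadow_comap_loc 𝓢 K hviii hτ hcart ⟨closure K₉, isClosed_closure⟩ ⟨Z₉, hZ₉⟩ V hKD hυ'
      (by rw [show ((⟨closure K₉, isClosed_closure⟩ : Closeds F₉) : Set F₉) = K₉ from hKc.symm]; exact fun x hx => hKdense hx.1)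
    rw [h]
    congr 2
    refine Closeds.ext ?_
    change closure (υ' ⁻¹' (closure K₉ \ Z₉)) = closure (closure (υ' ⁻¹' (K₉ \ Z₉)))
    rw [closure_closure, ← hKc]
  have hk3 : Flat (((𝓢 ⊔ K).comap τ ⊔ strictTransformIdeal τ (𝓢 ⊔ K) K).subschemeι ≫ (τ ≫ σ) ≫ q) := by
    have h := coneRound_flat 𝓢 K hviii hτ (σ ≫ q) hii
    simpa only [Category.assoc] using h
  have hk4reg : Scheme.IsRegular ((𝓢 ⊔ K).comap τ ⊔ strictTransformIdeal τ (𝓢 ⊔ K) K).subscheme :=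
    coneRound_isRegular 𝓢 K hviii hτ hCreg
  have hk4 : ∀ y : F₁₀, j₂ y ∈ (((𝓢 ⊔ K).comap τ ⊔ strictTransformIdeal τ (𝓢 ⊔ K) K).support : Set X₂) →
      stalkIdeal (vanishingIdeal (⟨υ' ⁻¹' Z₉, hZ₉.preimage υ'.continuous⟩ : Closeds F₁₀) ⊔
        vanishingIdeal (⟨closure (closure (υ' ⁻¹' (K₉ \ Z₉))), isClosed_closure⟩ : Closeds F₁₀)) y =
      stalkIdeal (vanishingIdeal (⟨υ' ⁻¹' Z₉ ∩ closure (closure (υ' ⁻¹' (K₉ \ Z₉))),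
        (hZ₉.preimage υ'.continuous).inter isClosed_closure⟩ : Closeds F₁₀)) y →
      IsRegularLocalRing (X₂.presheaf.stalk (j₂ y) ⧸
        stalkIdeal ((𝓢 ⊔ K).comap τ ⊔ strictTransformIdeal τ (𝓢 ⊔ K) K) (j₂ y)) := by
    intro y hy _
    obtain ⟨s, hs⟩ : j₂ y ∈ Set.range ((𝓢 ⊔ K).comap τ ⊔ strictTransformIdeal τ (𝓢 ⊔ K) K).subschemeι := by
      rw [Scheme.IdealSheafData.range_subschemeι]; exact hy
    have h := (isRegularLocalRing_stalk_subscheme_iff _ s).mp (hk4reg s)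
    rw [show ((𝓢 ⊔ K).comap τ ⊔ strictTransformIdeal τ (𝓢 ⊔ K) K).subschemeι.base s = j₂ y from hs] at h
    exact h
  -- (k-v) the new exceptional surface cuts a Cartier divisor on the new cone (saturation)
  have hk5 : IsEffectiveCartier (((𝓢 ⊔ K).comap τ).comap (strictTransformIdeal τ (𝓢 ⊔ K) K).subschemeι) :=
    isEffectiveCartier_cone_next 𝓢 K hτ
  -- the cone is non-zero: `K·𝒪_{F₉} = 𝓘⟨closure K₉⟩ ≠ ⊥` as `K₉ ≠ F₉`
  have hKne' : K ≠ ⊥ := by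
    intro hK0
    -- on `V` the local trace would make `closure K₉ ⊇ V`, a non-empty open of the irreducible `F₉`
    have hVK : (V : Set F₉) ⊆ closure K₉ := fun x hx =>
      (mem_support_iff_mem_closure_of_comap_ι_eq jG K K₉ V hKD hx).mp (by rw [hK0, Scheme.IdealSheafData.support_bot]; trivial)
    obtain ⟨z, hz⟩ := hZinf.nonempty
    have hdenseV : Dense (V : Set F₉) := V.2.dense ⟨z, hZV hz⟩
    apply hKne
    rw [← hKcl.closure_eq]
    exact Set.eq_univ_of_univ_subset ((hdenseV.closure_eq ▸ closure_minimal hVK isClosed_closure :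
      (Set.univ : Set F₉) ⊆ closure K₉))
  have hStne : strictTransformIdeal τ (𝓢 ⊔ K) K ≠ ⊥ := by
    intro h0
    have hle : K.comap τ ≤ strictTransformIdeal τ (𝓢 ⊔ K) K := comap_le_strictTransformIdeal τ (𝓢 ⊔ K) K
    rw [h0, le_bot_iff] at hle
    have hz := stalkIdeal_ne_bot_of_ne_bot hKne' (τ (j₂ t'))
    apply hz
    have h3 : stalkIdeal (K.comap τ) (j₂ t') = ⊥ := by rw [hle, stalkIdeal_bot]
    rw [stalkIdeal_comap_eq_map_stalkMap] at h3
    exact (Ideal.map_eq_bot_iff_of_injective (hτ.stalkMap_injective (j₂ t'))).mp h3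
  -- (k-vi) the new cone cuts a Cartier divisor on the new exceptional surface
  have hk6 : IsEffectiveCartier ((strictTransformIdeal τ (𝓢 ⊔ K) K).comap ((𝓢 ⊔ K).comap τ).subschemeι) :=
    isEffectiveCartier_comap_subschemeι_swap ((𝓢 ⊔ K).comap τ) (strictTransformIdeal τ (𝓢 ⊔ K) K) he2 hk1 he3 hStne hk5
  -- ===================== THE SEEDED MEMBER `St S₉` WITH MODEL `𝓕 := St_{𝓢 ⊔ K} 𝓢` (T23-A″-S) =====================
  -- the co-host Cartier hypothesis `K|_{V(𝓢)}` effective Cartier: clause (viii) swapped (𝓢, K locally principal, `V(𝓢)` regular, `K ≠ ⊥`)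
  have hK𝓢 : IsEffectiveCartier (K.comap 𝓢.subschemeι) :=
    isEffectiveCartier_comap_subschemeι_swap 𝓢 K (fun z => (hiiip z).1) (fun z => (hiiip z).2) hiii hKne' hviii
  -- (e-i) the member's trace: `(St 𝓢)·𝒪_{F₁₀} = 𝓘⟨closure υ'⁻¹(S₉ ∖ Z₉)⟩` (res-D-pv-051's exceptional transport through the cone round `𝓔 := 𝓢`)
  have hSc : (⟨closure S₉, isClosed_closure⟩ : Closeds F₉) = ⟨S₉, hScl⟩ := Closeds.ext hScl.closure_eq
  have hf1 : (strictTransformIdeal τ (𝓢 ⊔ K) 𝓢).comap j₂ =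
      vanishingIdeal (⟨closure (υ' ⁻¹' (S₉ \ Z₉)), isClosed_closure⟩ : Closeds F₁₀) := by
    have h := coneRound_exceptional_comap 𝓢 K hK𝓢 hτ hcart ⟨S₉, hScl⟩ ⟨Z₉, hZ₉⟩ (by rw [← hSc]; exact hix) hυ' hSdense
    exact h
  -- (e-ii) locally principal
  have hf2 : ∀ z : X₂, (stalkIdeal (strictTransformIdeal τ (𝓢 ⊔ K) 𝓢) z).IsPrincipal := fun z =>
    isPrincipal_stalkIdeal_strictTransformIdeal hXreg hCreg hτ hCne 𝓢 (fun z => (hiiip z).1) z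
  -- (e-iii) regular: `V(St 𝓢) ≅ V(𝓢)` (the strict transform along a Cartier divisor of `V(𝓢)` is an isomorphism)
  obtain ⟨eS, heS⟩ := exists_iso_subscheme_strictTransformIdeal_exceptional 𝓢 K hK𝓢 hτ
  have hf3 : Scheme.IsRegular (strictTransformIdeal τ (𝓢 ⊔ K) 𝓢).subscheme := Scheme.IsRegular.of_isOpenImmersion eS.hom hiii
  -- (e-iv) off the generic point of `Y`: `supp St 𝓢 ⊆ τ⁻¹ supp 𝓢` and `σ '' supp 𝓢` is off the generic point because `T₉ ⊄ closure S₉`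
  have h𝓢off : σ '' (𝓢.support : Set X) ⊆ {p : P | ¬ IsGenericPoint p Y} :=
    image_support_subset_not_isGenericPoint_of_chain θ hθ q Y hYsp σ S (hChain _ _ _ hCh) jG tG hsq T₉ hTS 𝓢 (closure S₉)
      isClosed_closure hix (fun h => hTS₉ (h.trans hScl.closure_subset))
  have hf4 : (τ ≫ σ) '' ((strictTransformIdeal τ (𝓢 ⊔ K) 𝓢).support : Set X₂) ⊆ {p : P | ¬ IsGenericPoint p Y} := by
    rintro _ ⟨z, hz, rfl⟩
    rw [Scheme.Hom.comp_apply]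
    exact h𝓢off ⟨τ z, apply_mem_support_of_mem_support_strictTransformIdeal 𝓢 hz, rfl⟩
  -- downstairs bookkeeping of the member: closed, and NOT containing the new running curve (`T₉` irreducible, `⊄ S₉`, `⊄ Z₉`)
  have hTS₁₀ : ¬ closure (υ' ⁻¹' (T₉ \ Z₉)) ⊆ closure (υ' ⁻¹' (S₉ \ Z₉)) := by
    intro hsub
    -- a point of `T₉` outside `S₉ ∪ Z₉`
    have hTSZ : ¬ T₉ ⊆ S₉ ∪ Z₉ := fun h => by
      rcases (isPreirreducible_iff_isClosed_union_isClosed.mp hT₉irr.isPreirreducible) _ _ hScl hZ₉ h with h' | h'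
      · exact hTS₉ h'
      · exact hTZ h'
    obtain ⟨u, huT, hu⟩ := Set.not_subset.mp hTSZ
    have huS : u ∉ S₉ := fun h => hu (Or.inl h)
    have huZ : u ∉ Z₉ := fun h => hu (Or.inr h)
    obtain ⟨u', hu'⟩ := hυ'.exists_preimage_of_not_mem_support (z := u) (by rw [hsuppZ]; exact huZ)
    have h1 : u' ∈ closure (υ' ⁻¹' (T₉ \ Z₉)) := subset_closure (show υ' u' ∈ T₉ \ Z₉ by rw [hu']; exact ⟨huT, huZ⟩)
    have h2 : u' ∈ υ' ⁻¹' S₉ :=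
      (closure_minimal (fun z hz => hz.1) (hScl.preimage υ'.continuous) : closure (υ' ⁻¹' (S₉ \ Z₉)) ⊆ υ' ⁻¹' S₉) (hsub h1)
    rw [Set.mem_preimage, hu'] at h2
    exact huS h2
  -- assemble
  refine ⟨hυ', hZinf, hF₂, isClosed_closure, hirr, hZ₉.preimage υ'.continuous, hTE, ?_, X₂, τ ≫ σ, _, j₂, t₂, hCh₂, hint₂, hnoeth₂,
    hreg₂, hdom₂, hsq₂, rfl, fun hE => Or.inr ⟨(𝓢 ⊔ K).comap τ, he1, he2, he3, he4, ?_,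
      Or.inr ⟨_, hk1, ⟨υ' ⁻¹ᵁ V, Set.preimage_mono hZV, hk2⟩, hk3, hk4, hk5, hk6⟩⟩, ?_⟩
  · -- the retained list `[St S₉]`: closed, not containing the running curve
    intro F hF
    rw [List.mem_singleton] at hF
    subst hF
    exact ⟨isClosed_closure, hTS₁₀⟩
  · exact hRuled X σ S jG tG 𝓢 K X₂ τ j₂ t₂ hCh hXint hXnoeth hXreg hdom hsq hTS hCD hii hCreg hiii hτ hsq₂ hcomm
  · -- the retained list `[St S₉]`: the member datum `Exc₃ … (St S₉) hF ∅` with model `St_{𝓢 ⊔ K} 𝓢`, shadow forgotten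
    intro F hF hFcl
    rw [List.mem_singleton] at hF
    subst hF
    exact Or.inr ⟨strictTransformIdeal τ (𝓢 ⊔ K) 𝓢, hf1, hf2, hf3, hf4,
      hRuledS X σ S jG tG 𝓢 K X₂ τ j₂ t₂ hCh hXint hXnoeth hXreg hdom hsq hTS hCD hii hCreg hiii hτ hsq₂ hcomm hix hSflat, Or.inl rfl⟩

/-! ## At `Ruled := FE` (the B′/B″ engines' datum «the surface's model is `O`-flat»): both stand-ins discharged -/

/-- **THE CURVE STEP `TCPlus.InvS ⇒ Tower.InvB … [St S₉] …` AT THE DATUM `FE := Flat (𝓔.subschemeι ≫ σ ≫ q)`, NO STAND-IN**: `hRuled` by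
`flat_exceptional_of_isBlowup_regularCentre` (the new exceptional surface of a regular `O`-flat centre, as V10′'s `hFEbirth`), `hRuledS` by
res-L1-w45b-stub-2's T-STFLAT-GEN `flat_strictTransform_subschemeι_comp_stage` over clause (x). [cite: Liu2002, Thm. 8.1.19] [cite: Hartshorne1977, III Prop. 9.7]
[OURS · L1 W4.5b · T23-A″-S] clause (curve) of the B″-S engine at `FE`, brick (S-8) (stmt-ResolutionOfSingularities-20148 / -20038); NOT a statement of the
manuscript. -/
theorem Tower.invB_of_invS_curveStep_FE (O : Type) [CommRing O] [IsDomain O] [IsDiscreteValuationRing O] (k : Type) [Field k]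
    (θ : O →+* k) (hθ : Function.Surjective θ)
    (P : Scheme.{0}) (q : P ⟶ Spec (.of O)) [IsProper q] (Y : Set P) (hYsp : Y ⊆ q ⁻¹' {closedPoint O})
    (hYirr : IsIrreducible Y) (hYcl : IsClosed Y) (hPnoeth : IsLocallyNoetherian P) (hPreg : Scheme.IsRegular P)
    (Ch : ∀ X' : Scheme.{0}, (X' ⟶ P) → Set X' → Prop)
    (hChain : ∀ (X' : Scheme.{0}) (σ : X' ⟶ P) (S : Set X'), Ch X' σ S → Chain P Y X' σ S)
    (hStep : ∀ (X' X'' : Scheme.{0}) (σ' : X' ⟶ P) (S' : Set X') (C : X'.IdealSheafData) (τ : X'' ⟶ X'),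
      Ch X' σ' S' → IsBlowup τ C → Scheme.IsRegular C.subscheme → Flat (C.subschemeι ≫ σ' ≫ q) →
      σ' '' (C.support : Set X') ⊆ {x : P | ¬ IsGenericPoint x Y} →
      (C.support : Set X') ∩ (σ' ≫ q) ⁻¹' {IsLocalRing.closedPoint O} ⊆ S' →
      Ch X'' (τ ≫ σ') (closure (τ ⁻¹' (S' \ (C.support : Set X')))))
    {F₁ F₂ : Scheme.{0}} (W : Set F₁) (F₉ : Scheme.{0}) (β₉ : F₉ ⟶ F₂) (T₉ Z₉ K₉ S₉ : Set F₉) (b₉ : Bool) (hZ₉ : IsClosed Z₉)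
    (F₁₀ : Scheme.{0}) (υ' : F₁₀ ⟶ F₉)
    (hI : TCPlus.InvS O k θ P q Y Ch W F₉ β₉ T₉ Z₉ K₉ S₉ b₉) (hZinf : Z₉.Infinite) (hKcl : IsClosed K₉) (hKne : K₉ ≠ Set.univ)
    (hKdense : K₉ ⊆ closure (K₉ \ Z₉))
    (hScl : IsClosed S₉) (hSdense : S₉ ⊆ closure (S₉ \ Z₉)) (hTS₉ : ¬ T₉ ⊆ S₉)
    (hZT : Z₉ ⊆ T₉) (hTZ : ¬ T₉ ⊆ Z₉) (hυ' : IsBlowup υ' (vanishingIdeal ⟨Z₉, hZ₉⟩)) :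
    Tower.InvB O k θ P q Y Ch (fun _ _ _ _ _ _ _ _ _ σ _ 𝓔 => Flat (𝓔.subschemeι ≫ σ ≫ q)) F₉ Z₉ hZ₉ F₁₀ υ' F₁₀ (𝟙 F₁₀)
      (closure (υ' ⁻¹' (T₉ \ Z₉))) (υ' ⁻¹' Z₉) [closure (υ' ⁻¹' (S₉ \ Z₉))] (closure (υ' ⁻¹' (K₉ \ Z₉))) :=
  Tower.invB_of_invS_curveStep O k θ hθ P q Y hYsp hYirr hYcl hPnoeth hPreg Ch hChain hStep _ W F₉ β₉ T₉ Z₉ K₉ S₉ b₉ hZ₉ F₁₀ υ' hI hZinf hKcl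
    hKne hKdense hScl hSdense hTS₉ hZT hTZ hυ'
    (fun X σ S jG tG 𝓢 K X₁₀ τ j₁₀ t₁₀ _ _ hXnoeth hXreg _ _ _ _ hCflat hCreg _ hτ _ _ => by
      haveI := hXnoeth
      have h := flat_exceptional_of_isBlowup_regularCentre O X X₁₀ (σ ≫ q) (𝓢 ⊔ K) hXreg hCreg hCflat τ hτ
      simpa only [Category.assoc] using h)
    (fun X σ S jG tG 𝓢 K X₁₀ τ j₁₀ t₁₀ _ _ hXnoeth _ _ _ _ _ _ _ _ hτ _ _ _ hSflat => by
      haveI := hXnoeth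
      haveI : IsLocallyNoetherian X₁₀ := by
        haveI : IsProper τ := hτ.isProper
        exact LocallyOfFiniteType.isLocallyNoetherian τ
      exact flat_strictTransform_subschemeι_comp_stage O σ q τ (𝓢 ⊔ K) hτ 𝓢 hSflat)

end Summit.ResolutionOfSingularities.ResolutionOfSingularities.Cruxes.EquisingularLiftNat.Sections

end
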